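import Literature.Computability.Cryptography.ChenQuantumLWECrossClassProfile
import Literature.Computability.Cryptography.ChenQuantumLWEClassIsSecret
import Literature.Computability.Cryptography.ChenQuantumLWERobustMeasurement

/-!
# No near-certain regime for a wrong direction (T29: the robust forms of T28; census §37)

REPRODUCTION / ANALYSIS OF A CLAIMED RESULT UNDER ADJUDICATION (withdrawn): Yilei Chen, *Quantum
Algorithms for Lattice Problems*, IACR ePrint 2024/555, version of 2024-04-18 [ChenQuantumLattice2024]
(the version carrying the author's note that Step 9 contains a bug), Step 9 (§3.5.9, pp. 34–38) acting
on the line kets `|φ_{b,v′}⟩ = Σ_{j ∈ ℤ_P} ψ_P(−j²) |2D²j·b + v′ mod N⟩` (p. 35) of the planted vector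
`b = [−1, 2p₁(…)ᵀ]ᵀ` of eq. (12) (p. 17), `P = p₁Q` odd, `N = D²P`; §3.3 (pp. 18–20) Cond. C.1–C.3 and
Lemma 3.6 (3) (p. 17) as transcribed in `ChenQuantumLWEParameterRegime.lean` (T27).  Bundle
`papers/QuantumAdvantage/lwe-quantum-autopsy/`, Part 2 (`REPAIR-CENSUS.md` §37; theorem **T29**; census
row G7), sequel of `ChenQuantumLWEClassIsSecret.lean` (T28: the EXACT-certainty equality forms — a
datum-certain measurement on the line kets of two short head-`(−1)` directions forces them to be equal),
of `ChenQuantumLWECrossClassProfile.lean` (T20: the exact success `1/#span_Q(b − b′)` of the datum reader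
of `b` on every line ket of `b′`), of `ChenQuantumLWETwoClassLaw.lean` (T19: the two-class law and its
`1/3` floor inside Chen's class) and of `ChenQuantumLWERobustMeasurement.lean` (Part 1: `ε`-almost-certain
outcomes on two non-orthogonal states coincide).  It answers REFEREE remark R-71.1 ("the approximate
version and the general rival are by hand / absent") by stating exactly which approximate versions hold
and with which tolerance.  HONEST FRAMING: kernel-checked THEOREMS about measurements of states occurring
in a WITHDRAWN algorithm — NOT summit progress, no cryptanalytic claim in either direction, no new
algorithm, no hardness claim; quantum lower bounds are out of scope.

## What is proved

Throughout `b, b′` are head-`(−1)` directions, `P = p₁Q` is odd, `2D²p₁` is a unit mod `Q`, and "the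
probability" of the datum reader of `b` (T18, `datumReader b`) on the line ket `|φ_{b′,w′}⟩` means
`⟨φ|E_{datum(w′)}|φ⟩/⟨φ|φ⟩` as in T20.

**1. The reader against ANY rival: a `1`-or-`≤ 1/3` dichotomy** (`datumReader_cross_prob_le_inv_minFac`,
`datumReader_certain_or_prob_le_third`, `intCast_eq_of_datumReader_cross_prob_gt`,
`eq_of_datumReader_cross_prob_gt_third`).  If `b ≢ b′ (mod Q)` at some coordinate, the reader of `b` reads
the datum of EVERY line ket of `b′` with probability `≤ 1/minFac Q ≤ 1/3` (T20's `1/#span_Q(b − b′)` with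
T19's `#span ≥ minFac Q ≥ 3`); so either the reader is datum-CERTAIN on every line ket of `b′` (same class
mod `Q`, T18) or it is right with probability `≤ 1/3` on every one of them — there is no near-certain
regime, for any rival `b′` whatsoever (not only rivals of the planted shape).  Consequently a success
probability `> 1/minFac Q` (in particular `> 1/3`) on ONE line ket of `b′` forces `b ≡ b′ (mod Q)`, and
`b = b′` when all coordinates of both are `2|·| < Q` — the robust form of T28's
`datumReader_certain_iff_eq`, which needed certainty on ALL line kets.

**2. Any measurement, inside Chen's class: the `1/3` floor in the equality form**
(`secretShift_eq_secretShift_iff`, `eps_floor_of_secretShift_ne`, `secretShift_eq_of_secretSuccess_gt`).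
Two members `b + 2p₁s₀𝟙_U`, `b + 2p₁s₁𝟙_U` of the class are equal as integer vectors iff
`(s₁ − s₀)|_U = 0`; hence T19's floor reads: if ANY POVM has sub-class datum success `≥ 1 − ε` on the
sub-classes of two DIFFERENT members then `ε ≥ ½(1 − 1/minFac Q) ≥ 1/3`, i.e. success `> 2/3` on two
sub-classes forces the two directions to be the same vector — the robust form of T28's `eq_of_certain_both`
INSIDE the class (this item only re-types T19's `eps_floor`; it is recorded so that the census sentence
"circular at the secret" has its approximate form by name).

**3. Any measurement, any rival: the pairwise tolerance `1/(4P²)`** (`one_le_norm_dotProduct_phi8bKet_cross`,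
`not_almostCertain_pair`, `not_almostCertain_both`, `eq_of_almostCertain_both`,
`eq_of_almostCertain_both_of_conditions`).  The crossing pair of T18 — `|φ_{b,v′}⟩` and
`|φ_{b′, v′ + 2D²(b_i − b′_i)·b}⟩`, both of squared norm `P` — has `|⟨·|·⟩| = #(common points) ≥ 1`
(rigidity: the amplitude product is the constant `ψ_P((b_i − b′_i)²)` on the common support).  By Part 1's
`POVM.eq_of_almostCertain_of_overlap_le`, if `b_i ≢ b′_i (mod Q)` then NO POVM is `ε`-almost certain
(`POVM.AlmostCertain`: Born weight `≥ (1 − ε)⟨ψ|ψ⟩`) of the datum on both kets once `4εP² < 1`; hence no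
POVM is `ε`-almost certain of the datum on all line kets of `b` and of `b′` for two directions in different
classes mod `Q`, and for short directions (`2|·| < Q`) `ε`-almost-certainty on both families forces
`b = b′` — T28's `eq_of_certain_both` is the case `ε = 0`.  `eq_of_almostCertain_both_of_conditions`
discharges shortness from the transcribed C.1–C.3 and Lemma 3.6 (3) exactly as T28 does (T28's
`two_mul_natAbs_lt_of_conditions`).

`Shape` wrappers under `Shape.Admissible`: `Shape.datumReader_certain_or_prob_le_third`,
`Shape.eq_of_datumReader_cross_prob_gt_third`, `Shape.eq_of_almostCertain_both`.

## What is NOT here (scope, honestly)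

The tolerance of item 3 is `ε < 1/(4P²)`, astronomically small at Chen's sizes: it is what PAIRWISE
non-orthogonality of two crossing kets yields (they share `gcd(P, b − b′)` of their `P` points), nothing
more.  The dimension-free floor `1/3` of item 2 needs the AVERAGE over a sub-class (T19's two-class law via
T15) and is proved only for pairs inside Chen's class `b + 2p₁ℤ_Q^U`; whether every pair of head-`(−1)`
directions in different classes mod `Q` obeys the same law `P_E(b) + P_E(b′) ≤ 1 + 1/#span_Q(b − b′)` for
every POVM (the reader of `b` attains it, item 1) is NOT proved here and we know no counterexample.  Also
not here: sample complexity of repeated measurements, the complexity of building any of these measurements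
from the instance (by T28/T29 a near-certain one names `b mod Q`), Cond. C.4–C.7.
-/

namespace Literature.Computability.Cryptography.Chen2024

open scoped BigOperators ComplexOrder
open Matrix

/-! ### 0. Short integers and residues (private helpers, as in T28) -/

/-- Two integers of absolute value `< m/2` that are congruent mod `m` are equal. [folklore] -/
private theorem eq_of_intCast_eq {m : ℕ} {x y : ℤ} (hx : 2 * x.natAbs < m) (hy : 2 * y.natAbs < m)
    (h : (x : ZMod m) = (y : ZMod m)) : x = y := by
  have hdvd : (m : ℤ) ∣ y - x := (ZMod.intCast_eq_intCast_iff_dvd_sub x y m).1 h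
  have hlt : (y - x).natAbs < (m : ℤ).natAbs := by
    rw [Int.natAbs_natCast]
    exact lt_of_le_of_lt (Int.natAbs_sub_le y x) (by omega)
  have h0 := Int.eq_zero_of_dvd_of_natAbs_lt_natAbs hdvd hlt
  omega

/-- Coordinatewise. [folklore] -/
private theorem eq_of_forall_intCast_eq {ι : Type*} {m : ℕ} {x y : ι → ℤ}
    (hx : ∀ i, 2 * (x i).natAbs < m) (hy : ∀ i, 2 * (y i).natAbs < m)
    (h : ∀ i, ((x i : ℤ) : ZMod m) = ((y i : ℤ) : ZMod m)) : x = y :=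
  funext fun i => eq_of_intCast_eq (hx i) (hy i) (h i)

/-- Two distinct short vectors differ mod `m` at some coordinate. [folklore] -/
private theorem exists_intCast_ne_of_ne {ι : Type*} {m : ℕ} {x y : ι → ℤ}
    (hx : ∀ i, 2 * (x i).natAbs < m) (hy : ∀ i, 2 * (y i).natAbs < m) (hne : x ≠ y) :
    ∃ i, ((x i : ℤ) : ZMod m) ≠ ((y i : ℤ) : ZMod m) := by
  obtain ⟨i, hi⟩ := Function.ne_iff.1 hne
  exact ⟨i, fun h => hi (eq_of_intCast_eq (hx i) (hy i) h)⟩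

/-! ### 1. The reader of `b` against any rival `b′`: certain, or at most `1/3` -/

section Reader

variable (n : ℕ) (D p₁ Q : ℕ+) (b : Fin (n + 1) → ℤ)

/-- `δ̄ = b − b′ mod Q` vanishes iff `b ≡ b′ (mod Q)` coordinatewise. [folklore] -/
private theorem dirDiffQ_eq_zero_iff (b' : Fin (n + 1) → ℤ) :
    dirDiffQ n Q b b' = 0 ↔ ∀ k, ((b k : ℤ) : ZQ Q) = ((b' k : ℤ) : ZQ Q) := by
  constructor
  · intro h k
    have hk := congr_fun h k
    simpa only [dirDiffQ, Pi.zero_apply, Int.cast_sub, sub_eq_zero] using hk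
  · intro h
    funext k
    simp only [dirDiffQ, Pi.zero_apply, Int.cast_sub, sub_eq_zero, h k]

/-- **Profile F is at most `1/minFac Q ≤ 1/3` off the class (T20 + T19).**  If `b ≢ b′ (mod Q)`
(`δ̄ ≠ 0`), the datum reader of `b` reads the datum of the line ket `|φ_{b′,w′}⟩` with probability
`1/#span_Q(δ̄) ≤ 1/minFac Q`, and `≤ 1/3` (`Q` odd) — for EVERY offset `w′` and every rival `b′`.
[cite: ChenQuantumLattice2024, §3.5.9 pp. 35–37, Cond. C.3 p. 18; NielsenChuang2010, §2.2.6 p. 90; census §37] -/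
theorem datumReader_cross_prob_le_inv_minFac (hP : Odd ((p₁ * Q : ℕ+) : ℕ)) (hb : b 0 = -1)
    (b' : Fin (n + 1) → ℤ) (hb' : b' 0 = -1) (hunit : IsUnit ((2 * D * D * p₁ : ℕ) : ZQ Q))
    (hδ : dirDiffQ n Q b b' ≠ 0) (w' : Fin (n + 1) → ℤ) :
    ((datumReader n D p₁ Q b hP hb).weight (phi8bKet n D p₁ Q b' w')
            (toDatum D p₁ Q ((w' 0 : ℤ) : ZN D p₁ Q))).re
          / (star (phi8bKet n D p₁ Q b' w') ⬝ᵥ phi8bKet n D p₁ Q b' w').re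
        ≤ (((((Q : ℕ+) : ℕ).minFac : ℕ) : ℝ))⁻¹
      ∧ ((datumReader n D p₁ Q b hP hb).weight (phi8bKet n D p₁ Q b' w')
            (toDatum D p₁ Q ((w' 0 : ℤ) : ZN D p₁ Q))).re
          / (star (phi8bKet n D p₁ Q b' w') ⬝ᵥ phi8bKet n D p₁ Q b' w').re
        ≤ 1 / 3 := by
  rw [datumReader_cross_prob n D p₁ Q b hP hb b' hb' hunit w']
  have hS3 : (3 : ℝ) ≤ Nat.card (span Q (dirDiffQ n Q b b')) := by
    exact_mod_cast three_le_card_span Q (odd_Q_of_odd_P p₁ Q hP) hδ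
  have hmf : ((((Q : ℕ+) : ℕ).minFac : ℕ) : ℝ) ≤ Nat.card (span Q (dirDiffQ n Q b b')) := by
    exact_mod_cast minFac_le_card_span Q hδ
  have hmf0 : (0 : ℝ) < ((((Q : ℕ+) : ℕ).minFac : ℕ) : ℝ) := by exact_mod_cast Nat.minFac_pos _
  refine ⟨inv_anti₀ hmf0 hmf, ?_⟩
  rw [one_div]
  exact inv_anti₀ (by norm_num) hS3

/-- **The dichotomy: certain, or at most `1/3` — no near-certain regime (T29, item 1).**  For any rival
head-`(−1)` direction `b′`: EITHER the datum reader of `b` is datum-certain on every line ket of `b′`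
(`b ≡ b′ (mod Q)`, T18) OR it reads the datum with probability `≤ 1/3` on every line ket of `b′`.
[cite: ChenQuantumLattice2024, §3.5.9 pp. 35–37; NielsenChuang2010, §2.2.6 p. 90; census §37] -/
theorem datumReader_certain_or_prob_le_third (hP : Odd ((p₁ * Q : ℕ+) : ℕ)) (hb : b 0 = -1)
    (b' : Fin (n + 1) → ℤ) (hb' : b' 0 = -1) (hunit : IsUnit ((2 * D * D * p₁ : ℕ) : ZQ Q)) :
    (∀ w' : Fin (n + 1) → ℤ, (datumReader n D p₁ Q b hP hb).Certain (phi8bKet n D p₁ Q b' w')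
        (toDatum D p₁ Q ((w' 0 : ℤ) : ZN D p₁ Q)))
      ∨ ∀ w' : Fin (n + 1) → ℤ,
        ((datumReader n D p₁ Q b hP hb).weight (phi8bKet n D p₁ Q b' w')
              (toDatum D p₁ Q ((w' 0 : ℤ) : ZN D p₁ Q))).re
            / (star (phi8bKet n D p₁ Q b' w') ⬝ᵥ phi8bKet n D p₁ Q b' w').re
          ≤ 1 / 3 := by
  by_cases hδ : dirDiffQ n Q b b' = 0
  · exact Or.inl (datumReader_certain_of_dirCongr n D p₁ Q b hP hb b' hb' hunit
      ((dirDiffQ_eq_zero_iff n Q b b').1 hδ))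
  · exact Or.inr fun w' => (datumReader_cross_prob_le_inv_minFac n D p₁ Q b hP hb b' hb' hunit hδ w').2

/-- **Beating `1/minFac Q` on ONE ket names the class.**  If the datum reader of `b` reads the datum of a
single line ket `|φ_{b′,w′}⟩` with probability `> 1/minFac Q`, then `b ≡ b′ (mod Q)` coordinatewise.
[cite: ChenQuantumLattice2024, §3.5.9 pp. 35–37; NielsenChuang2010, §2.2.6 p. 90; census §37] -/
theorem intCast_eq_of_datumReader_cross_prob_gt (hP : Odd ((p₁ * Q : ℕ+) : ℕ)) (hb : b 0 = -1)
    (b' : Fin (n + 1) → ℤ) (hb' : b' 0 = -1) (hunit : IsUnit ((2 * D * D * p₁ : ℕ) : ZQ Q))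
    (w' : Fin (n + 1) → ℤ)
    (hgt : (((((Q : ℕ+) : ℕ).minFac : ℕ) : ℝ))⁻¹ <
      ((datumReader n D p₁ Q b hP hb).weight (phi8bKet n D p₁ Q b' w')
            (toDatum D p₁ Q ((w' 0 : ℤ) : ZN D p₁ Q))).re
          / (star (phi8bKet n D p₁ Q b' w') ⬝ᵥ phi8bKet n D p₁ Q b' w').re) :
    ∀ k, ((b k : ℤ) : ZQ Q) = ((b' k : ℤ) : ZQ Q) := by
  by_contra hne
  have hδ : dirDiffQ n Q b b' ≠ 0 := fun h => hne ((dirDiffQ_eq_zero_iff n Q b b').1 h)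
  exact absurd (datumReader_cross_prob_le_inv_minFac n D p₁ Q b hP hb b' hb' hunit hδ w').1
    (not_le.2 hgt)

/-- **Beating `1/3` on ONE ket names the class** (`Q` odd: `minFac Q ≥ 3`).
[cite: ChenQuantumLattice2024, §3.5.9 pp. 35–37, Cond. C.3 p. 18; NielsenChuang2010, §2.2.6 p. 90; census §37] -/
theorem intCast_eq_of_datumReader_cross_prob_gt_third (hP : Odd ((p₁ * Q : ℕ+) : ℕ)) (hb : b 0 = -1)
    (b' : Fin (n + 1) → ℤ) (hb' : b' 0 = -1) (hunit : IsUnit ((2 * D * D * p₁ : ℕ) : ZQ Q))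
    (w' : Fin (n + 1) → ℤ)
    (hgt : (1 : ℝ) / 3 <
      ((datumReader n D p₁ Q b hP hb).weight (phi8bKet n D p₁ Q b' w')
            (toDatum D p₁ Q ((w' 0 : ℤ) : ZN D p₁ Q))).re
          / (star (phi8bKet n D p₁ Q b' w') ⬝ᵥ phi8bKet n D p₁ Q b' w').re) :
    ∀ k, ((b k : ℤ) : ZQ Q) = ((b' k : ℤ) : ZQ Q) := by
  by_contra hne
  have hδ : dirDiffQ n Q b b' ≠ 0 := fun h => hne ((dirDiffQ_eq_zero_iff n Q b b').1 h)
  exact absurd (datumReader_cross_prob_le_inv_minFac n D p₁ Q b hP hb b' hb' hunit hδ w').2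
    (not_le.2 hgt)

/-- **The robust form of T28's `datumReader_certain_iff_eq` (T29, item 1).**  For head-`(−1)` directions
`b, b′` with all coordinates `2|·| < Q`: if the datum reader of `b` reads the datum of ONE line ket of
`b′` with probability `> 1/3`, then `b = b′` — at Chen's sizes (T28, item 2) a reader that is merely
better than `1/3` on one line ket of a rival planted vector was built from that vector.
[cite: ChenQuantumLattice2024, §3.5.9 pp. 35–37, eq. (12) p. 17; NielsenChuang2010, §2.2.6 p. 90; census §27.5 (ii), §37] -/
theorem eq_of_datumReader_cross_prob_gt_third (hP : Odd ((p₁ * Q : ℕ+) : ℕ)) (hb : b 0 = -1)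
    (b' : Fin (n + 1) → ℤ) (hb' : b' 0 = -1) (hunit : IsUnit ((2 * D * D * p₁ : ℕ) : ZQ Q))
    (hsm : ∀ k, 2 * (b k).natAbs < ((Q : ℕ+) : ℕ)) (hsm' : ∀ k, 2 * (b' k).natAbs < ((Q : ℕ+) : ℕ))
    (w' : Fin (n + 1) → ℤ)
    (hgt : (1 : ℝ) / 3 <
      ((datumReader n D p₁ Q b hP hb).weight (phi8bKet n D p₁ Q b' w')
            (toDatum D p₁ Q ((w' 0 : ℤ) : ZN D p₁ Q))).re
          / (star (phi8bKet n D p₁ Q b' w') ⬝ᵥ phi8bKet n D p₁ Q b' w').re) :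
    b = b' :=
  eq_of_forall_intCast_eq hsm hsm'
    (intCast_eq_of_datumReader_cross_prob_gt_third n D p₁ Q b hP hb b' hb' hunit w' hgt)

end Reader

/-! ### 2. Any measurement, inside Chen's class: T19's floor in the equality form -/

section InClass

variable (n : ℕ) (D p₁ Q : ℕ+)

/-- Two class members `b + 2p₁s₀𝟙_U`, `b + 2p₁s₁𝟙_U` (secrets lifted to `[0, Q)`) are the same integer
vector iff `(s₁ − s₀)|_U = 0`. [cite: ChenQuantumLattice2024, eq. (12) p. 17] -/
theorem secretShift_eq_secretShift_iff (b : Fin (n + 1) → ℤ) (U : Finset (Fin (n + 1)))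
    (s₀ s₁ : Fin (n + 1) → ZQ Q) :
    b + secretShift n p₁ Q U s₀ = b + secretShift n p₁ Q U s₁ ↔ secretDiff n Q U s₀ s₁ = 0 := by
  rw [add_right_inj, secretDiff_eq_zero_iff]
  constructor
  · intro h i hi
    have hi' := congr_fun h i
    simp only [secretShift, classTail, if_pos hi] at hi'
    have hp : (2 * ((p₁ : ℕ) : ℤ)) ≠ 0 := by positivity
    have hv : (((s₀ i).val : ℕ) : ℤ) = (((s₁ i).val : ℕ) : ℤ) := mul_left_cancel₀ hp hi'
    exact (ZMod.val_injective _ (Nat.cast_inj.1 hv)).symm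
  · intro h
    funext i
    simp only [secretShift, classTail]
    split_ifs with hi
    · rw [h i hi]
    · rfl

/-- **T19's floor for two DIFFERENT members (T29, item 2).**  Under T19's hypotheses (`P` odd,
`b ≡ bk` off `U`, `p₁ ∣ b, bk` on `U`, a unit coordinate of `bk` off `U`): if a POVM has sub-class datum
success `≥ 1 − ε` on the sub-classes of two members that are different integer vectors, then
`ε ≥ ½(1 − 1/minFac Q)` and `ε ≥ 1/3`.  (Re-typing of `eps_floor`: "different vectors" ⇔ `δ ≠ 0`.)
[cite: ChenQuantumLattice2024, §3.5.9 pp. 35–37, eq. (12) p. 17, Cond. C.3 p. 18; NielsenChuang2010, Box 2.3 p. 87; census §37] -/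
theorem eps_floor_of_secretShift_ne (hP : Odd ((p₁ * Q : ℕ+) : ℕ)) (U : Finset (Fin (n + 1)))
    (bk b v' : Fin (n + 1) → ℤ)
    (hb : ∀ i ∈ U, ((p₁ : ℕ) : ℤ) ∣ b i) (hbkU : ∀ i ∈ U, ((p₁ : ℕ) : ℤ) ∣ bk i)
    (hbk : ∀ i, i ∉ U → bk i = b i) (hunit : ∃ i₀, i₀ ∉ U ∧ IsUnit ((bk i₀ : ℤ) : ZQ Q))
    (E : POVM (Fin (n + 1) → ZN D p₁ Q) (ZQ Q)) {s₀ s₁ : Fin (n + 1) → ZQ Q}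
    (hne : b + secretShift n p₁ Q U s₀ ≠ b + secretShift n p₁ Q U s₁) {ε : ℝ}
    (h₀ : 1 - ε ≤ secretSuccess n D p₁ Q U bk b v' E s₀)
    (h₁ : 1 - ε ≤ secretSuccess n D p₁ Q U bk b v' E s₁) :
    (1 - ((((Q : ℕ+) : ℕ).minFac : ℕ) : ℝ)⁻¹) / 2 ≤ ε ∧ (1 : ℝ) / 3 ≤ ε :=
  eps_floor n D p₁ Q hP U bk b v' hb hbkU hbk hunit E
    (fun h => hne ((secretShift_eq_secretShift_iff n p₁ Q b U s₀ s₁).2 h)) h₀ h₁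

/-- **The robust form of T28's `eq_of_certain_both` inside the class (T29, item 2).**  Under T19's
hypotheses: a POVM with sub-class datum success `> 2/3` (`≥ 1 − ε`, `ε < 1/3`) on the sub-classes of two
members `b + 2p₁s₀𝟙_U`, `b + 2p₁s₁𝟙_U` forces the two directions to be the SAME integer vector.
[cite: ChenQuantumLattice2024, §3.5.9 pp. 35–37, eq. (12) p. 17; NielsenChuang2010, Box 2.3 p. 87; census §27.5 (ii), §37] -/
theorem secretShift_eq_of_secretSuccess_gt (hP : Odd ((p₁ * Q : ℕ+) : ℕ)) (U : Finset (Fin (n + 1)))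
    (bk b v' : Fin (n + 1) → ℤ)
    (hb : ∀ i ∈ U, ((p₁ : ℕ) : ℤ) ∣ b i) (hbkU : ∀ i ∈ U, ((p₁ : ℕ) : ℤ) ∣ bk i)
    (hbk : ∀ i, i ∉ U → bk i = b i) (hunit : ∃ i₀, i₀ ∉ U ∧ IsUnit ((bk i₀ : ℤ) : ZQ Q))
    (E : POVM (Fin (n + 1) → ZN D p₁ Q) (ZQ Q)) (s₀ s₁ : Fin (n + 1) → ZQ Q) {ε : ℝ}
    (hε : ε < 1 / 3)
    (h₀ : 1 - ε ≤ secretSuccess n D p₁ Q U bk b v' E s₀)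
    (h₁ : 1 - ε ≤ secretSuccess n D p₁ Q U bk b v' E s₁) :
    b + secretShift n p₁ Q U s₀ = b + secretShift n p₁ Q U s₁ := by
  by_contra hne
  exact absurd (eps_floor_of_secretShift_ne n D p₁ Q hP U bk b v' hb hbkU hbk hunit E hne h₀ h₁).2
    (not_le.2 hε)

end InClass

/-! ### 3. Any measurement, any rival: the pairwise tolerance `1/(4P²)` -/

section Pairwise

variable (n : ℕ) (D p₁ Q : ℕ+) (b : Fin (n + 1) → ℤ)

/-- **The crossing pair overlaps in at least one unit of amplitude.**  For heads `−1` and `P` odd,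
`|⟨φ_{b,v′} | φ_{b′, v′ + 2D²(b_i − b′_i)·b}⟩| = #(common points) ≥ 1`: on the common support the
amplitude product is the constant `ψ_P((b_i − b′_i)²)` (T18's rigidity), and the two lines meet.
[cite: ChenQuantumLattice2024, §3.5.9 p. 35; folklore] -/
theorem one_le_norm_dotProduct_phi8bKet_cross (hP : Odd ((p₁ * Q : ℕ+) : ℕ)) (hb : b 0 = -1)
    (b' : Fin (n + 1) → ℤ) (hb' : b' 0 = -1) (v' : Fin (n + 1) → ℤ) (i : Fin (n + 1)) :
    1 ≤ ‖star (phi8bKet n D p₁ Q b v') ⬝ᵥ phi8bKet n D p₁ Q b' (lineShift n D b v' (b i - b' i))‖ := by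
  classical
  have hinj := ptB_injective n D p₁ Q b v' hP hb
  have hinj' := ptB_injective n D p₁ Q b' (lineShift n D b v' (b i - b' i)) hP hb'
  have hrig : ∀ z, phi8bKet n D p₁ Q b v' z ≠ 0 →
      phi8bKet n D p₁ Q b' (lineShift n D b v' (b i - b' i)) z ≠ 0 →
      (starRingEnd ℂ) (phi8bKet n D p₁ Q b v' z)
          * phi8bKet n D p₁ Q b' (lineShift n D b v' (b i - b' i)) z
        = (ZMod.stdAddChar ((((b i - b' i : ℤ) : ZP p₁ Q)) ^ 2) : ℂ) := by
    intro z hz hz'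
    obtain ⟨j, rfl⟩ : ∃ j, z = ptB n D p₁ Q b v' j := by
      by_contra hcon
      push Not at hcon
      exact hz (by unfold phi8bKet; exact lineKet_apply_of_ne _ _ hcon)
    obtain ⟨j', hj'⟩ :
        ∃ j', ptB n D p₁ Q b v' j = ptB n D p₁ Q b' (lineShift n D b v' (b i - b' i)) j' := by
      by_contra hcon
      push Not at hcon
      exact hz' (by unfold phi8bKet; exact lineKet_apply_of_ne _ _ hcon)
    obtain ⟨hjj, hzero⟩ := ptB_eq_ptB_lineShift n D p₁ Q b hP hb b' hb' v' (b i - b' i) hj'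
    have hψ : phi8bKet n D p₁ Q b v' (ptB n D p₁ Q b v' j)
        = (ZMod.stdAddChar (-(j ^ 2) : ZP p₁ Q) : ℂ) := by
      unfold phi8bKet; exact lineKet_apply_pt hinj _ j
    have hφ : phi8bKet n D p₁ Q b' (lineShift n D b v' (b i - b' i)) (ptB n D p₁ Q b v' j)
        = (ZMod.stdAddChar (-(j' ^ 2) : ZP p₁ Q) : ℂ) := by
      rw [hj']; unfold phi8bKet; exact lineKet_apply_pt hinj' _ j'
    have hjc : j' * ((b i - b' i : ℤ) : ZP p₁ Q) = 0 := by
      have h2 : ((2 * ((D : ℕ) : ℤ) ^ 2 * (((j'.val : ℕ) : ℤ) * (b i - b' i)) : ℤ) : ZN D p₁ Q)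
          = 0 := by
        rw [← hzero i]; push_cast; ring
      have h3 := intCast_ZP_eq_zero_of_twoDsq_mul D p₁ Q hP h2
      simpa only [Int.cast_mul, Int.cast_natCast, ZMod.natCast_zmod_val] using h3
    rw [hψ, hφ, ← AddChar.map_neg_eq_conj, ← AddChar.map_add_eq_mul]
    congr 1
    rw [hjj]
    linear_combination (2 : ZP p₁ Q) * hjc
  have hne := dotProduct_phi8bKet_cross_ne_zero n D p₁ Q b hP hb b' hb' v' i
  rw [dotProduct_eq_card_mul_of_rigid _ _ hrig] at hne ⊢
  have hζ : ‖(ZMod.stdAddChar ((((b i - b' i : ℤ) : ZP p₁ Q)) ^ 2) : ℂ)‖ = 1 := by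
    rw [ZMod.stdAddChar_apply, Circle.norm_coe]
  have hcard := (mul_ne_zero_iff.1 hne).1
  rw [norm_mul, Complex.norm_natCast, hζ, mul_one]
  exact_mod_cast Nat.one_le_iff_ne_zero.2 (Nat.cast_ne_zero.1 hcard)

/-- **No measurement is `ε`-almost certain of the datum across classes, `4εP² < 1` (T29, item 3).**  If
`b_i ≢ b′_i (mod Q)` (heads `−1`, `P` odd, `2D²p₁` a unit mod `Q`) and `4εP² < 1`, no POVM is
`ε`-almost certain of the datum on both `|φ_{b,v′}⟩` and `|φ_{b′, v′ + 2D²(b_i − b′_i)·b}⟩`: the two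
kets have squared norms `P` and overlap `≥ 1`, so Part 1's `POVM.eq_of_almostCertain_of_overlap_le`
would force equal data, whereas the data differ by the unit multiple `2D²(b_i − b′_i)` of T18.
[cite: ChenQuantumLattice2024, §3.5.9 pp. 35–37; NielsenChuang2010, Box 2.3 p. 87, §9.2 pp. 403–409; census §37] -/
theorem not_almostCertain_pair (hP : Odd ((p₁ * Q : ℕ+) : ℕ)) (hb : b 0 = -1)
    (b' : Fin (n + 1) → ℤ) (hb' : b' 0 = -1) (hunit : IsUnit ((2 * D * D * p₁ : ℕ) : ZQ Q))
    {i : Fin (n + 1)} (hi : ((b i : ℤ) : ZQ Q) ≠ ((b' i : ℤ) : ZQ Q))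
    (E : POVM (Fin (n + 1) → ZN D p₁ Q) (ZQ Q)) (v' : Fin (n + 1) → ℤ) {ε : ℝ}
    (hε : 4 * ε * (((p₁ * Q : ℕ+) : ℕ) : ℝ) ^ 2 < 1) :
    ¬ (E.AlmostCertain ε (phi8bKet n D p₁ Q b v') (toDatum D p₁ Q ((v' 0 : ℤ) : ZN D p₁ Q))
        ∧ E.AlmostCertain ε (phi8bKet n D p₁ Q b' (lineShift n D b v' (b i - b' i)))
            (toDatum D p₁ Q ((lineShift n D b v' (b i - b' i) 0 : ℤ) : ZN D p₁ Q))) := by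
  classical
  rintro ⟨h1, h2⟩
  have hne := dotProduct_phi8bKet_cross_ne_zero n D p₁ Q b hP hb b' hb' v' i
  have hov : (star (phi8bKet n D p₁ Q b v') ⬝ᵥ phi8bKet n D p₁ Q b v').re
        * (star (phi8bKet n D p₁ Q b' (lineShift n D b v' (b i - b' i)))
            ⬝ᵥ phi8bKet n D p₁ Q b' (lineShift n D b v' (b i - b' i))).re
      ≤ (((p₁ * Q : ℕ+) : ℕ) : ℝ) ^ 2
        * ‖star (phi8bKet n D p₁ Q b v')
            ⬝ᵥ phi8bKet n D p₁ Q b' (lineShift n D b v' (b i - b' i))‖ ^ 2 := by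
    rw [phi8bKet_normSq n D p₁ Q hP b hb, phi8bKet_normSq n D p₁ Q hP b' hb']
    have hPre : ((((p₁ * Q : ℕ+) : ℕ) : ℂ)).re = (((p₁ * Q : ℕ+) : ℕ) : ℝ) := by
      rw [← Complex.ofReal_natCast, Complex.ofReal_re]
    rw [hPre]
    have h1' := one_le_norm_dotProduct_phi8bKet_cross n D p₁ Q b hP hb b' hb' v' i
    have hsq : (1 : ℝ) ≤ ‖star (phi8bKet n D p₁ Q b v')
        ⬝ᵥ phi8bKet n D p₁ Q b' (lineShift n D b v' (b i - b' i))‖ ^ 2 := one_le_pow₀ h1'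
    have hP0 : (0 : ℝ) ≤ (((p₁ * Q : ℕ+) : ℕ) : ℝ) ^ 2 := sq_nonneg _
    calc (((p₁ * Q : ℕ+) : ℕ) : ℝ) * (((p₁ * Q : ℕ+) : ℕ) : ℝ)
        = (((p₁ * Q : ℕ+) : ℕ) : ℝ) ^ 2 * 1 := by ring
      _ ≤ (((p₁ * Q : ℕ+) : ℕ) : ℝ) ^ 2 * ‖star (phi8bKet n D p₁ Q b v')
            ⬝ᵥ phi8bKet n D p₁ Q b' (lineShift n D b v' (b i - b' i))‖ ^ 2 :=
          mul_le_mul_of_nonneg_left hsq hP0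
  have heq := E.eq_of_almostCertain_of_overlap_le h1 h2 hε hov hne
  rw [toDatum_lineShift n D p₁ Q b hb v' (b i - b' i)] at heq
  have hc : ((b i - b' i : ℤ) : ZQ Q) ≠ 0 := by rwa [Int.cast_sub, sub_ne_zero]
  apply hc
  have h0 : ((2 * D * D : ℕ) : ZQ Q) * ((b i - b' i : ℤ) : ZQ Q) = 0 := by
    linear_combination heq
  exact ((isUnit_twoDD_modQ D p₁ Q hunit).mul_right_eq_zero).1 h0

/-- Hence, for `4εP² < 1`, no measurement is `ε`-almost certain of the datum on ALL line kets of two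
directions in different classes mod `Q`. [cite: ChenQuantumLattice2024, §3.5.9 pp. 35–37; NielsenChuang2010, Box 2.3 p. 87; census §37] -/
theorem not_almostCertain_both (hP : Odd ((p₁ * Q : ℕ+) : ℕ)) (hb : b 0 = -1)
    (b' : Fin (n + 1) → ℤ) (hb' : b' 0 = -1) (hunit : IsUnit ((2 * D * D * p₁ : ℕ) : ZQ Q))
    {i : Fin (n + 1)} (hi : ((b i : ℤ) : ZQ Q) ≠ ((b' i : ℤ) : ZQ Q))
    (E : POVM (Fin (n + 1) → ZN D p₁ Q) (ZQ Q)) {ε : ℝ}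
    (hε : 4 * ε * (((p₁ * Q : ℕ+) : ℕ) : ℝ) ^ 2 < 1) :
    ¬ ((∀ v' : Fin (n + 1) → ℤ,
          E.AlmostCertain ε (phi8bKet n D p₁ Q b v') (toDatum D p₁ Q ((v' 0 : ℤ) : ZN D p₁ Q)))
        ∧ ∀ w' : Fin (n + 1) → ℤ,
          E.AlmostCertain ε (phi8bKet n D p₁ Q b' w') (toDatum D p₁ Q ((w' 0 : ℤ) : ZN D p₁ Q))) :=
  fun h => not_almostCertain_pair n D p₁ Q b hP hb b' hb' hunit hi E 0 hε ⟨h.1 0, h.2 _⟩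

/-- **The robust form of T28's `eq_of_certain_both` for any rival (T29, item 3).**  For head-`(−1)`
directions `b, b′` with all coordinates `2|·| < Q` and `4εP² < 1`: a measurement that is `ε`-almost
certain of the datum on all line kets of `b` and on all line kets of `b′` forces `b = b′` (T28 is
`ε = 0`).  The tolerance `1/(4P²)` is what the pairwise overlap of two crossing kets gives and no more.
[cite: ChenQuantumLattice2024, §3.5.9 pp. 35–37, eq. (12) p. 17; NielsenChuang2010, Box 2.3 p. 87; census §27.5 (ii), §37] -/
theorem eq_of_almostCertain_both (hP : Odd ((p₁ * Q : ℕ+) : ℕ)) (hb : b 0 = -1)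
    (b' : Fin (n + 1) → ℤ) (hb' : b' 0 = -1) (hunit : IsUnit ((2 * D * D * p₁ : ℕ) : ZQ Q))
    (hsm : ∀ k, 2 * (b k).natAbs < ((Q : ℕ+) : ℕ)) (hsm' : ∀ k, 2 * (b' k).natAbs < ((Q : ℕ+) : ℕ))
    (E : POVM (Fin (n + 1) → ZN D p₁ Q) (ZQ Q)) {ε : ℝ}
    (hε : 4 * ε * (((p₁ * Q : ℕ+) : ℕ) : ℝ) ^ 2 < 1)
    (h₁ : ∀ v' : Fin (n + 1) → ℤ,
      E.AlmostCertain ε (phi8bKet n D p₁ Q b v') (toDatum D p₁ Q ((v' 0 : ℤ) : ZN D p₁ Q)))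
    (h₂ : ∀ w' : Fin (n + 1) → ℤ,
      E.AlmostCertain ε (phi8bKet n D p₁ Q b' w') (toDatum D p₁ Q ((w' 0 : ℤ) : ZN D p₁ Q))) :
    b = b' := by
  by_contra hne
  obtain ⟨i, hi⟩ := exists_intCast_ne_of_ne hsm hsm' hne
  exact not_almostCertain_both n D p₁ Q b hP hb b' hb' hunit hi E hε ⟨h₁, h₂⟩

/-- **Assembled from the printed conditions (as T28's `eq_of_certain_both_of_conditions`).**  For the
planted vector `b` of an instance satisfying C.1–C.3 (with `log n ≥ 1`) and Lemma 3.6 (3), any rival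
head-`(−1)` vector `b′` satisfying Lemma 3.6 (3) with the same `p₁, S₂, β, κ`, and `4εP² < 1`: a
measurement `ε`-almost certain of the datum on all line kets of `b` and of `b′` forces `b = b′`.  (The
real parameters `D′, p′` of the transcribed conditions are not identified with the register's `D, p₁`;
only `Q` is shared, through C.3.)
[cite: ChenQuantumLattice2024, §3.3 pp. 18–20 (Cond. C.1, C.2, C.3), Lemma 3.6 p. 17, eq. (12) p. 17, §3.5.9 pp. 35–37; NielsenChuang2010, Box 2.3 p. 87; census §27.5, §37] -/
theorem eq_of_almostCertain_both_of_conditions (hP : Odd ((p₁ * Q : ℕ+) : ℕ)) (hb : b 0 = -1)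
    (b' : Fin (n + 1) → ℤ) (hb' : b' 0 = -1) (hunit : IsUnit ((2 * D * D * p₁ : ℕ) : ZQ Q))
    {L D' u t M N p' S₂ β κ : ℝ} (hL : 1 ≤ L) (hD : 0 < D') (hu : 0 < u) (hp : 0 < p')
    (hβ : 2 ≤ β) (hS₂ : 0 ≤ S₂) (hκ : 2 * κ ≤ (n + 1 : ℝ))
    (hC1 : 64 * L ^ 3 < t / u) (hC2u : u = D' * Real.sqrt (∑ i, ((b i : ℤ) : ℝ) ^ 2))
    (hC2M : M = 2 * (t ^ 2 + u ^ 2)) (hC3 : M / (2 * D' ^ 2) = N)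
    (hC3' : N = p' * (((Q : ℕ+) : ℕ) : ℝ))
    (h36 : ∃ θ : ℝ, 0.04 ≤ θ ∧ θ ≤ 0.27 ∧ (∑ i, ((b i : ℤ) : ℝ) ^ 2) =
      1 + 4 * p' ^ 2 * S₂ + θ * (4 * p' ^ 2 * β ^ 2 * ((n + 1 : ℝ) - κ)))
    (h36' : ∃ θ' : ℝ, 0.04 ≤ θ' ∧ θ' ≤ 0.27 ∧ (∑ i, ((b' i : ℤ) : ℝ) ^ 2) =
      1 + 4 * p' ^ 2 * S₂ + θ' * (4 * p' ^ 2 * β ^ 2 * ((n + 1 : ℝ) - κ)))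
    (E : POVM (Fin (n + 1) → ZN D p₁ Q) (ZQ Q)) {ε : ℝ}
    (hε : 4 * ε * (((p₁ * Q : ℕ+) : ℕ) : ℝ) ^ 2 < 1)
    (h₁ : ∀ v' : Fin (n + 1) → ℤ,
      E.AlmostCertain ε (phi8bKet n D p₁ Q b v') (toDatum D p₁ Q ((v' 0 : ℤ) : ZN D p₁ Q)))
    (h₂ : ∀ w' : Fin (n + 1) → ℤ,
      E.AlmostCertain ε (phi8bKet n D p₁ Q b' w') (toDatum D p₁ Q ((w' 0 : ℤ) : ZN D p₁ Q))) :
    b = b' :=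
  eq_of_almostCertain_both n D p₁ Q b hP hb b' hb' hunit
    (two_mul_natAbs_lt_of_conditions b b Q hL hD hu hp hβ hS₂ hκ hC1 hC2u hC2M hC3 hC3' h36 h36)
    (two_mul_natAbs_lt_of_conditions b b' Q hL hD hu hp hβ hS₂ hκ hC1 hC2u hC2M hC3 hC3' h36 h36')
    E hε h₁ h₂

end Pairwise

end Literature.Computability.Cryptography.Chen2024

/-! ### 4. For admissible shapes -/

namespace Literature.Computability.Cryptography.Chen2024.Shape

open Literature.Computability.Cryptography.Chen2024

variable (S : Shape)

/-- **T29 item 1 for admissible shapes.**  For any head-`(−1)` rival `b′`: the datum reader of `S.b` is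
either datum-certain on every line ket of `b′` or right with probability `≤ 1/3` on every one of them.
[cite: ChenQuantumLattice2024, §3.5.9 pp. 35–37; NielsenChuang2010, §2.2.6 p. 90; census §37] -/
theorem datumReader_certain_or_prob_le_third (h : S.Admissible) {b' : Fin (S.n + 1) → ℤ}
    (hb' : b' 0 = -1) :
    (∀ w' : Fin (S.n + 1) → ℤ,
        (Chen2024.datumReader S.n S.D S.p₁ S.Q S.b h.odd_P h.b_head).Certain
          (phi8bKet S.n S.D S.p₁ S.Q b' w') (toDatum S.D S.p₁ S.Q ((w' 0 : ℤ) : ZN S.D S.p₁ S.Q)))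
      ∨ ∀ w' : Fin (S.n + 1) → ℤ,
        ((Chen2024.datumReader S.n S.D S.p₁ S.Q S.b h.odd_P h.b_head).weight
              (phi8bKet S.n S.D S.p₁ S.Q b' w') (toDatum S.D S.p₁ S.Q ((w' 0 : ℤ) : ZN S.D S.p₁ S.Q))).re
            / (star (phi8bKet S.n S.D S.p₁ S.Q b' w') ⬝ᵥ phi8bKet S.n S.D S.p₁ S.Q b' w').re
          ≤ 1 / 3 :=
  Chen2024.datumReader_certain_or_prob_le_third S.n S.D S.p₁ S.Q S.b h.odd_P h.b_head b' hb'
    h.isUnit_twoDDp₁_modQ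

/-- **T29 item 1 for admissible shapes: better than `1/3` on one ket names the secret.**  If all
coordinates of `S.b` and of a head-`(−1)` rival `b′` are `2|·| < Q` and the datum reader of `S.b` reads the
datum of one line ket of `b′` with probability `> 1/3`, then `b′ = S.b`.
[cite: ChenQuantumLattice2024, §3.5.9 pp. 35–37, eq. (12) p. 17; NielsenChuang2010, §2.2.6 p. 90; census §27.5 (ii), §37] -/
theorem eq_of_datumReader_cross_prob_gt_third (h : S.Admissible)
    (hsm : ∀ k, 2 * (S.b k).natAbs < (S.Q : ℕ)) {b' : Fin (S.n + 1) → ℤ} (hb' : b' 0 = -1)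
    (hsm' : ∀ k, 2 * (b' k).natAbs < (S.Q : ℕ)) (w' : Fin (S.n + 1) → ℤ)
    (hgt : (1 : ℝ) / 3 <
      ((Chen2024.datumReader S.n S.D S.p₁ S.Q S.b h.odd_P h.b_head).weight
            (phi8bKet S.n S.D S.p₁ S.Q b' w') (toDatum S.D S.p₁ S.Q ((w' 0 : ℤ) : ZN S.D S.p₁ S.Q))).re
          / (star (phi8bKet S.n S.D S.p₁ S.Q b' w') ⬝ᵥ phi8bKet S.n S.D S.p₁ S.Q b' w').re) :
    S.b = b' :=
  Chen2024.eq_of_datumReader_cross_prob_gt_third S.n S.D S.p₁ S.Q S.b h.odd_P h.b_head b' hb'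
    h.isUnit_twoDDp₁_modQ hsm hsm' w' hgt

/-- **T29 item 3 for admissible shapes: an `ε`-almost-certain measurement names the secret
(`4εP² < 1`).**  If a measurement is `ε`-almost certain of the datum on all line kets of `S.b` and of a
head-`(−1)` rival `b′`, all coordinates of both being `2|·| < Q`, then `b′ = S.b`.
[cite: ChenQuantumLattice2024, §3.5.9 pp. 35–37, eq. (12) p. 17; NielsenChuang2010, Box 2.3 p. 87; census §27.5 (ii), §37] -/
theorem eq_of_almostCertain_both (h : S.Admissible) (hsm : ∀ k, 2 * (S.b k).natAbs < (S.Q : ℕ))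
    {b' : Fin (S.n + 1) → ℤ} (hb' : b' 0 = -1) (hsm' : ∀ k, 2 * (b' k).natAbs < (S.Q : ℕ))
    (E : POVM (Fin (S.n + 1) → ZN S.D S.p₁ S.Q) (ZQ S.Q)) {ε : ℝ}
    (hε : 4 * ε * ((S.P : ℕ) : ℝ) ^ 2 < 1)
    (h₁ : ∀ v' : Fin (S.n + 1) → ℤ,
      E.AlmostCertain ε (phi8bKet S.n S.D S.p₁ S.Q S.b v')
        (toDatum S.D S.p₁ S.Q ((v' 0 : ℤ) : ZN S.D S.p₁ S.Q)))
    (h₂ : ∀ w' : Fin (S.n + 1) → ℤ,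
      E.AlmostCertain ε (phi8bKet S.n S.D S.p₁ S.Q b' w')
        (toDatum S.D S.p₁ S.Q ((w' 0 : ℤ) : ZN S.D S.p₁ S.Q))) :
    S.b = b' :=
  Chen2024.eq_of_almostCertain_both S.n S.D S.p₁ S.Q S.b h.odd_P h.b_head b' hb' h.isUnit_twoDDp₁_modQ
    hsm hsm' E hε h₁ h₂

end Literature.Computability.Cryptography.Chen2024.Shape
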